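import Literature.MathematicalPhysics.QuantumLattice.ChronologicalGramBound
import Mathlib.Data.Fin.Tuple.Sort
import HarnessLib

/-!
# The chronological determinant bound for arbitrary time labels (Pedra–Salmhofer 2008, Lemma 3.9)

Topic `MathematicalPhysics/QuantumLattice`; companion of `ChronologicalGramBound.lean`. There the
two-kernel determinant bound `norm_det_chronological_le` is proved for STAIRCASE patterns
`a < k_b` (monotone `k`). In applications (determinant / tree expansions of many-fermion systems)
the rows and columns carry TIMES `τ_a`, `τ'_b` in a linear order, in no particular order, and the
pattern is `τ'_b < τ_a` (or `τ'_b ≤ τ_a`); sorting rows and columns by decreasing time — which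
changes the determinant only by a sign — turns it into a staircase (de Siqueira Pedra–Salmhofer
2008, proof of Lemma 3.9). This file performs that reduction:

* `lt_iff_lt_card_filter_of_antitone` — for an antitone tuple, `{a | c < g a}` is the initial
  segment of length `#{a | c < g a}`;
* **`norm_det_chronological_le_of_times`** — `|det [ τ'_b < τ_a ? Σ u_a v_b : Σ p_a q_b ]| ≤
  ∏_a √(‖u_a‖² + ‖p_a‖²) ∏_b √(‖v_b‖² + ‖q_b‖²)` for arbitrary `τ, τ' : Fin n → J`;
* **`norm_det_chronological_le_of_times'`** — the same with the non-strict pattern `τ'_b ≤ τ_a`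
  (by transposition).

Everything is PROVED; no definition.

## References

* W. de Siqueira Pedra, M. Salmhofer, Comm. Math. Phys. 282 (2008) 797–818, Lemma 3.9.
  [PedraSalmhofer2008]
-/

noncomputable section

open scoped Matrix
open Finset Equiv

namespace Literature.MathematicalPhysics.QuantumLattice

/-- For an antitone tuple `g : Fin n → J` and a threshold `c`, the set `{a | c < g a}` is an
initial segment: `c < g a ↔ a < #{a' | c < g a'}`. [folklore] -/
theorem lt_iff_lt_card_filter_of_antitone {J : Type*} [LinearOrder J] {n : ℕ} {g : Fin n → J}
    (hg : Antitone g) (c : J) (a : Fin n) :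
    c < g a ↔ (a : ℕ) < (univ.filter fun a' : Fin n => c < g a').card := by
  constructor
  · intro ha
    have hsub : Finset.Iic a ⊆ univ.filter fun a' : Fin n => c < g a' := by
      intro a' ha'
      rw [Finset.mem_Iic] at ha'
      exact mem_filter.2 ⟨mem_univ _, ha.trans_le (hg ha')⟩
    have := card_le_card hsub
    rw [Fin.card_Iic] at this
    omega
  · intro ha
    by_contra hc
    have hsub : (univ.filter fun a' : Fin n => c < g a') ⊆ Finset.Iio a := by
      intro a' ha'
      rw [Finset.mem_Iio]
      have hca' := (mem_filter.1 ha').2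
      by_contra hle
      exact hc (hca'.trans_le (hg (not_lt.mp hle)))
    have := card_le_card hsub
    rw [Fin.card_Iio] at this
    omega

/-- Sorting a tuple in DECREASING order: an antitone rearrangement. [folklore] -/
theorem exists_perm_antitone {J : Type*} [LinearOrder J] {n : ℕ} (g : Fin n → J) :
    ∃ σ : Equiv.Perm (Fin n), Antitone (g ∘ σ) := by
  refine ⟨Tuple.sort (OrderDual.toDual ∘ g), fun a b hab => ?_⟩
  have h := Tuple.monotone_sort (OrderDual.toDual ∘ g) hab
  exact h

variable {ι₁ ι₂ : Type*} [Fintype ι₁] [Fintype ι₂]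

/-- **The chronological determinant bound for arbitrary time labels** (de Siqueira
Pedra–Salmhofer 2008, Lemma 3.9 with Thm 1.3, two-kernel case): for rows with times `τ_a`, columns
with times `τ'_b` in a linear order `J`, and coordinate vectors `u_a, v_b` (kernel on `τ'_b < τ_a`),
`p_a, q_b` (kernel on `τ_a ≤ τ'_b`),
`|det [ τ'_b < τ_a ? Σ_i u_a(i) v_b(i) : Σ_j p_a(j) q_b(j) ]| ≤ ∏_a √(‖u_a‖₂²+‖p_a‖₂²) · ∏_b √(‖v_b‖₂²+‖q_b‖₂²)`.
Sort rows and columns by decreasing time (a sign), then `norm_det_chronological_le`.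
[cite: PedraSalmhofer2008, Lemma 3.9] -/
theorem norm_det_chronological_le_of_times {J : Type*} [LinearOrder J] {n : ℕ}
    (τ τ' : Fin n → J) (u v : Fin n → ι₁ → ℂ) (p q : Fin n → ι₂ → ℂ) :
    ‖(Matrix.of fun a b : Fin n =>
        if τ' b < τ a then ∑ i, u a i * v b i else ∑ j, p a j * q b j).det‖ ≤
      (∏ a, Real.sqrt (∑ i, ‖u a i‖ ^ 2 + ∑ j, ‖p a j‖ ^ 2)) *
        ∏ b, Real.sqrt (∑ i, ‖v b i‖ ^ 2 + ∑ j, ‖q b j‖ ^ 2) := by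
  obtain ⟨ρ, hρ⟩ := exists_perm_antitone τ
  obtain ⟨γ, hγ⟩ := exists_perm_antitone τ'
  set M : Matrix (Fin n) (Fin n) ℂ := Matrix.of fun a b : Fin n =>
    if τ' b < τ a then ∑ i, u a i * v b i else ∑ j, p a j * q b j with hM
  -- the staircase pattern of the sorted matrix
  set k : Fin n → ℕ := fun b => (univ.filter fun a' : Fin n => τ' (γ b) < τ (ρ a')).card with hk
  have hkmono : Monotone k := by
    intro b b' hbb'
    refine card_le_card fun a' ha' => ?_
    rw [mem_filter] at ha' ⊢
    exact ⟨ha'.1, (hγ hbb').trans_lt ha'.2⟩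
  have hkn : ∀ b, k b ≤ n := fun b => (card_le_univ _).trans_eq (by simp)
  have hpat : ∀ a b, (τ' (γ b) < τ (ρ a) ↔ (a : ℕ) < k b) := fun a b =>
    lt_iff_lt_card_filter_of_antitone hρ (τ' (γ b)) a
  -- the sorted matrix
  have hsub : M.submatrix ρ γ = Matrix.of fun a b : Fin n =>
      if (a : ℕ) < k b then ∑ i, u (ρ a) i * v (γ b) i else ∑ j, p (ρ a) j * q (γ b) j := by
    ext a b
    simp only [Matrix.submatrix_apply, hM, Matrix.of_apply]
    by_cases h : τ' (γ b) < τ (ρ a)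
    · rw [if_pos h, if_pos ((hpat a b).1 h)]
    · rw [if_neg h, if_neg (fun h' => h ((hpat a b).2 h'))]
  have hdet : ‖M.det‖ = ‖(M.submatrix ρ γ).det‖ := by
    have : M.submatrix ρ γ = (M.submatrix ρ id).submatrix id γ := by
      ext a b; simp
    rw [this, Matrix.det_permute', Matrix.det_permute, norm_mul, norm_mul]
    have h1 : ∀ σ : Perm (Fin n), ‖((Perm.sign σ : ℤ) : ℂ)‖ = 1 := fun σ => by
      rcases Int.units_eq_one_or (Perm.sign σ) with h | h <;> simp [h]
    rw [h1, h1, one_mul, one_mul]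
  rw [hdet, hsub]
  refine (norm_det_chronological_le (fun a => u (ρ a)) (fun b => v (γ b)) (fun a => p (ρ a))
    (fun b => q (γ b)) k hkmono hkn).trans (le_of_eq ?_)
  rw [Equiv.prod_comp ρ (fun a => Real.sqrt (∑ i, ‖u a i‖ ^ 2 + ∑ j, ‖p a j‖ ^ 2)),
    Equiv.prod_comp γ (fun b => Real.sqrt (∑ i, ‖v b i‖ ^ 2 + ∑ j, ‖q b j‖ ^ 2))]

/-- **The non-strict variant**: the same bound for the pattern `τ'_b ≤ τ_a` (creation at equal
time counted as LEFT of annihilation), by transposition from `norm_det_chronological_le_of_times`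
with rows and columns exchanged. [cite: PedraSalmhofer2008, Lemma 3.9] -/
theorem norm_det_chronological_le_of_times' {J : Type*} [LinearOrder J] {n : ℕ}
    (τ τ' : Fin n → J) (u v : Fin n → ι₁ → ℂ) (p q : Fin n → ι₂ → ℂ) :
    ‖(Matrix.of fun a b : Fin n =>
        if τ' b ≤ τ a then ∑ i, u a i * v b i else ∑ j, p a j * q b j).det‖ ≤
      (∏ a, Real.sqrt (∑ i, ‖u a i‖ ^ 2 + ∑ j, ‖p a j‖ ^ 2)) *
        ∏ b, Real.sqrt (∑ i, ‖v b i‖ ^ 2 + ∑ j, ‖q b j‖ ^ 2) := by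
  -- transpose: rows ↔ columns, strict pattern `τ a < τ' b` for the (p, q) kernel
  have hT : (Matrix.of fun a b : Fin n =>
        if τ' b ≤ τ a then ∑ i, u a i * v b i else ∑ j, p a j * q b j) =
      (Matrix.of fun b a : Fin n =>
        if τ a < τ' b then ∑ j, q b j * p a j else ∑ i, v b i * u a i)ᵀ := by
    ext a b
    simp only [Matrix.of_apply, Matrix.transpose_apply]
    by_cases h : τ' b ≤ τ a
    · rw [if_pos h, if_neg (not_lt.mpr h)]
      exact Finset.sum_congr rfl fun i _ => mul_comm _ _
    · rw [if_neg h, if_pos (not_le.mp h)]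
      exact Finset.sum_congr rfl fun j _ => mul_comm _ _
  rw [hT, Matrix.det_transpose, mul_comm]
  refine (norm_det_chronological_le_of_times τ' τ q p v u).trans (le_of_eq ?_)
  congr 1
  · exact Finset.prod_congr rfl fun b _ => by rw [add_comm]
  · exact Finset.prod_congr rfl fun a _ => by rw [add_comm]

end Literature.MathematicalPhysics.QuantumLattice
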